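import Summits.SmoothPoincare4.SmoothPoincare4.Theorems.ConvexBisectionAcyclicBisectionExistsBeltSlideTube
import Summits.SmoothPoincare4.SmoothPoincare4.Theorems.ConvexBisectionAcyclicBisectionExistsBeltPageLimit
import Literature.Topology.FourManifolds.BordismMerging
import Literature.Geometry.Symplectic.TwoHandleIsotopyProofs
import Literature.Geometry.Symplectic.AttachingCircleProofs
import HarnessLib

/-!
# Sliding the belt circle inside the handle, III: the framed belt circles of a multi-attachment are
# link-isotopic in `∂P` to the `r`-longitudes of the attaching circles
(node T3c-1 `node_belt_isotopic_pushoff` of the sub-goal T3 "the complement piece is the cap with the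
DUAL handles" of stub `stub_steinRealisation` (NF6), line `modp-braid-orbits`, crux
`ConvexBisection.AcyclicBisectionExists`, item stmt-SmoothPoincare4-10508; wave 2, worker V6, lead c5)

Sequel of `…BeltSlideRotation.lean`, `…BeltSlideTube.lean` (`slideInner b r t : T → D⁴ ∖ S`).  For
multi-attachment data `D` of a finite family `h` of 2-handle attaching maps on `M` (attached
manifold `P`, Kosinski's model `x ∼ h̄ α(x)`):

* §4 the slid belt circle `slideInner b r t (θ, 0) = (sin φ θ^{±}, cos φ θ)`
  (`coe_coe_slideInner_coreTubePt`; `= beltCirclePt θ` for `t ≤ 0`), the `r`-LONGITUDE point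
  **`tubeLongitudePt b r θ = (√(1-r²) θ^{±}, r θ) ∈ T`** of the attaching circle and Kosinski's
  inversion between them: `α (tubeLongitudePt b r θ) = slideInner b r 1 (θ, 0)` for `0 < r ≤ 1/2`
  (`handleInversion_tubeLongitudePt`);
* §5 **`slideMap D i b r t : HandleAttachingMap 3 2 P`** — the belt tube of handle `i` slid by the
  isoclinic rotation, `D.jB i ∘ slideInner b r t` (a smooth embedding with open range, `∂` to `∂`);
  at `t ≤ 0` it has the attaching circle AND the handle framing of the belt map `beltMap D i`
  (`attachingCircle_slideMap_of_nonpos`, `attachingFraming_slideMap_of_nonpos`: same germ at the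
  core); the stages are jointly smooth (`contMDiff_slideMap_uncurry`); **`slideIsotopy`** — the
  attaching circles of the slid belt maps form an isotopy of knots in `∂P`
  (`KnotIsotopyInBoundary`), **`isFramingAlong_slide`** — their handle framings carry the belt
  framing (`IsFramingAlong`; joint continuity into `TP`: the tangent map of the jointly smooth
  family applied to the continuous core section), **`slideLinkIsotopy`** — for all handles at once an
  isotopy of LINKS (each component in its own handle); **`attachingCircle_slideMap_one`** — the end
  knot is `θ ↦ D.jA (h̄ᵢ (tubeLongitudePt b r θ))`, the `r`-longitude of the attaching circle read on
  the base piece (`0 < r ≤ 1/2`);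
* §6 registered helper `helper_belt_slideLongitude`.

Sequel `…BeltSlideFraming.lean`: the end framing read on the base piece.  Everything here is proved;
no named facts.

## References
* A. A. Kosinski, *Differential Manifolds*, Academic Press (1993), VI §6, (6.1). [Kosinski1993]
* J. Milnor, *Lectures on the h-cobordism theorem* (1965), §3 (dual handles). [MilnorHCobordism1965]
* R. C. Kirby, *The Topology of 4-Manifolds*, LNM 1374 (1989), Ch. I §2 (framings). [Kirby1989]
* R. E. Gompf, A. I. Stipsicz, *4-Manifolds and Kirby Calculus* (1999), §8.2. [GompfStipsicz1999]
-/

noncomputable section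

-- the prescribed namespace `Summit.<P>.<Sub>.…` duplicates `SmoothPoincare4` (P = Sub)
set_option linter.dupNamespace false

open scoped Manifold ContDiff Topology
open Set Function Metric Real

namespace Summit.SmoothPoincare4.SmoothPoincare4.Theorems.AcyclicBisectionExists.ModpBraidOrbits

open Literature.Topology.FourManifolds Literature.Topology.FourManifolds.HandleAttachingMap

/-! ### §4 The slid belt circle and its glued partner in Kosinski's tube -/

/-- `|x_λ|² = 1 > 7/8` at the points of the attaching circle. [folklore] -/
theorem lt_lamSq_coreTubePt (θ : sphere (0 : EuclideanSpace ℝ (Fin 2)) 1) :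
    7 / 8 < lamSq 2 (((coreTubePt θ : ↥(handleTube 3 2)) : closedBall (0 : EuclideanSpace ℝ (Fin 4)) 1) :
      EuclideanSpace ℝ (Fin 4)) := by
  rw [coe_coe_coreTubePt, lamSq_corePt]; norm_num

/-- **The slid belt circle**: `G_{r,t} (θ, 0) = R_{φ_r(t)} (0, 0, θ) =
(sin φ · θ₀, ± sin φ · θ₁, cos φ · θ₀, cos φ · θ₁)`, `φ = φ_r(t)`. [folklore] -/
theorem coe_coe_slideInner_coreTubePt (b : Bool) (r t : ℝ) (θ : sphere (0 : EuclideanSpace ℝ (Fin 2)) 1) :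
    (((slideInner b r t (coreTubePt θ) : ↥(beltPiece 3 2)) : closedBall (0 : EuclideanSpace ℝ (Fin 4)) 1) :
      EuclideanSpace ℝ (Fin 4)) =
      WithLp.toLp 2 ![sin (slideAngle r t) * (θ : EuclideanSpace ℝ (Fin 2)) 0,
        slideSign b * sin (slideAngle r t) * (θ : EuclideanSpace ℝ (Fin 2)) 1,
        cos (slideAngle r t) * (θ : EuclideanSpace ℝ (Fin 2)) 0,
        cos (slideAngle r t) * (θ : EuclideanSpace ℝ (Fin 2)) 1] := by
  rw [coe_coe_slideInner_of_lt b r t (lt_lamSq_coreTubePt θ), coe_coe_coreTubePt]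
  ext i
  fin_cases i <;> simp [corePt]

/-- Before the slide starts the slid belt circle is the belt circle. [folklore] -/
theorem slideInner_coreTubePt_of_nonpos (b : Bool) (r : ℝ) {t : ℝ} (ht : t ≤ 0)
    (θ : sphere (0 : EuclideanSpace ℝ (Fin 2)) 1) : slideInner b r t (coreTubePt θ) = beltCirclePt θ := by
  rw [slideInner_of_nonpos b r ht, tubeRho_eq_self (lt_lamSq_coreTubePt θ)]; rfl

/-- The vector `(√(1-r²) θ₀, ± √(1-r²) θ₁, r θ₀, r θ₁)` of the `r`-longitude of the attaching
circle in Kosinski's tube. [folklore] -/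
def tubeLongitudeVec (b : Bool) (r : ℝ) (θ : sphere (0 : EuclideanSpace ℝ (Fin 2)) 1) : EuclideanSpace ℝ (Fin 4) :=
  WithLp.toLp 2 ![Real.sqrt (1 - r ^ 2) * (θ : EuclideanSpace ℝ (Fin 2)) 0,
    slideSign b * Real.sqrt (1 - r ^ 2) * (θ : EuclideanSpace ℝ (Fin 2)) 1,
    r * (θ : EuclideanSpace ℝ (Fin 2)) 0, r * (θ : EuclideanSpace ℝ (Fin 2)) 1]

/-- `|x_λ|² = 1 - r²` on the `r`-longitude (`r² ≤ 1`). [folklore] -/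
theorem lamSq_tubeLongitudeVec (b : Bool) {r : ℝ} (hr : r ^ 2 ≤ 1) (θ : sphere (0 : EuclideanSpace ℝ (Fin 2)) 1) :
    lamSq 2 (tubeLongitudeVec b r θ) = 1 - r ^ 2 := by
  have hs := slideSign_sq b
  have hθ : (θ : EuclideanSpace ℝ (Fin 2)) 0 ^ 2 + (θ : EuclideanSpace ℝ (Fin 2)) 1 ^ 2 = 1 := by
    have h2 : ‖(θ : EuclideanSpace ℝ (Fin 2))‖ ^ 2 = 1 := by rw [norm_eq_of_mem_sphere θ, one_pow]
    rwa [EuclideanSpace.real_norm_sq_eq, Fin.sum_univ_two] at h2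
  have hq : Real.sqrt (1 - r ^ 2) ^ 2 = 1 - r ^ 2 := Real.sq_sqrt (by linarith)
  rw [lamSq_two_fin_four]
  simp only [tubeLongitudeVec]
  simp
  linear_combination (1 - r ^ 2) * hθ + ((θ : EuclideanSpace ℝ (Fin 2)) 1 ^ 2 * (1 - r ^ 2)) * hs +
    ((θ : EuclideanSpace ℝ (Fin 2)) 0 ^ 2 + slideSign b ^ 2 * (θ : EuclideanSpace ℝ (Fin 2)) 1 ^ 2) * hq

/-- `‖x‖ = 1` on the `r`-longitude (`r² ≤ 1`): it lies on `∂D⁴`. [folklore] -/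
theorem norm_tubeLongitudeVec (b : Bool) {r : ℝ} (hr : r ^ 2 ≤ 1) (θ : sphere (0 : EuclideanSpace ℝ (Fin 2)) 1) :
    ‖tubeLongitudeVec b r θ‖ = 1 := by
  have hs := slideSign_sq b
  have hθ : (θ : EuclideanSpace ℝ (Fin 2)) 0 ^ 2 + (θ : EuclideanSpace ℝ (Fin 2)) 1 ^ 2 = 1 := by
    have h2 : ‖(θ : EuclideanSpace ℝ (Fin 2))‖ ^ 2 = 1 := by rw [norm_eq_of_mem_sphere θ, one_pow]
    rwa [EuclideanSpace.real_norm_sq_eq, Fin.sum_univ_two] at h2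
  have hq : Real.sqrt (1 - r ^ 2) ^ 2 = 1 - r ^ 2 := Real.sq_sqrt (by linarith)
  have e : ‖tubeLongitudeVec b r θ‖ ^ 2 = 1 := by
    rw [EuclideanSpace.norm_sq_eq, Fin.sum_univ_four]
    simp only [Real.norm_eq_abs, sq_abs, tubeLongitudeVec]
    simp
    linear_combination hθ + ((θ : EuclideanSpace ℝ (Fin 2)) 1 ^ 2 * (1 - r ^ 2)) * hs +
      ((θ : EuclideanSpace ℝ (Fin 2)) 0 ^ 2 + slideSign b ^ 2 * (θ : EuclideanSpace ℝ (Fin 2)) 1 ^ 2) * hq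
  nlinarith [norm_nonneg (tubeLongitudeVec b r θ)]

/-- **The `r`-longitude point `(√(1-r²) θ, ± , r θ)` of Kosinski's tube `T`** (for `r² < 1`; junk
`(θ, 0)` otherwise): the tube point at distance `r` from the attaching circle, of angle `θ` along
it and meridional angle `θ` (resp. `θ̄`) around it. [cite: Kosinski1993, VI §6] -/
def tubeLongitudePt (b : Bool) (r : ℝ) (θ : sphere (0 : EuclideanSpace ℝ (Fin 2)) 1) : ↥(handleTube 3 2) :=
  if hr : r ^ 2 < 1 then
    ⟨⟨tubeLongitudeVec b r θ, mem_closedBall_zero_iff.2 (norm_tubeLongitudeVec b hr.le θ).le⟩, by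
      rw [mem_handleTube]
      show lamSq 2 (tubeLongitudeVec b r θ) ≠ 0
      rw [lamSq_tubeLongitudeVec b hr.le θ]; linarith⟩
  else coreTubePt θ

/-- The vector of the `r`-longitude point. [folklore] -/
theorem coe_coe_tubeLongitudePt (b : Bool) {r : ℝ} (hr : r ^ 2 < 1) (θ : sphere (0 : EuclideanSpace ℝ (Fin 2)) 1) :
    (((tubeLongitudePt b r θ : ↥(handleTube 3 2)) : closedBall (0 : EuclideanSpace ℝ (Fin 4)) 1) :
      EuclideanSpace ℝ (Fin 4)) = tubeLongitudeVec b r θ := by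
  rw [tubeLongitudePt, dif_pos hr]

/-- The `r`-longitude is off the attaching sphere (`r ≠ 0`, `r² < 1`). [folklore] -/
theorem lamSq_tubeLongitudePt_ne_one (b : Bool) {r : ℝ} (h0 : r ≠ 0) (hr : r ^ 2 < 1)
    (θ : sphere (0 : EuclideanSpace ℝ (Fin 2)) 1) :
    lamSq 2 (((tubeLongitudePt b r θ : ↥(handleTube 3 2)) : closedBall (0 : EuclideanSpace ℝ (Fin 4)) 1) :
      EuclideanSpace ℝ (Fin 4)) ≠ 1 := by
  rw [coe_coe_tubeLongitudePt b hr, lamSq_tubeLongitudeVec b hr.le]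
  intro h
  exact h0 (by nlinarith)

/-- **Kosinski's inversion carries the `r`-longitude of `T` to the slid belt circle**:
`α (√(1-r²) θ, ±, r θ) = (r θ, ±, √(1-r²) θ) = G_{r,1} (θ, 0)` (`0 < r ≤ 1/2`).
[cite: Kosinski1993, VI (6.1)] -/
theorem handleInversion_tubeLongitudePt (b : Bool) {r : ℝ} (h0 : 0 < r) (h1 : r ≤ 1 / 2)
    (θ : sphere (0 : EuclideanSpace ℝ (Fin 2)) 1) :
    handleInversion 2 (((tubeLongitudePt b r θ : ↥(handleTube 3 2)) :
      closedBall (0 : EuclideanSpace ℝ (Fin 4)) 1) : EuclideanSpace ℝ (Fin 4)) =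
      (((slideInner b r 1 (coreTubePt θ) : ↥(beltPiece 3 2)) : closedBall (0 : EuclideanSpace ℝ (Fin 4)) 1) :
        EuclideanSpace ℝ (Fin 4)) := by
  have hr : r ^ 2 < 1 := by nlinarith
  have hl : lamSq 2 (tubeLongitudeVec b r θ) = 1 - r ^ 2 := lamSq_tubeLongitudeVec b hr.le θ
  have hA : Real.sqrt (1 - (1 - r ^ 2)) = r := by rw [sub_sub_cancel, Real.sqrt_sq h0.le]
  have hq0 : 0 < Real.sqrt (1 - r ^ 2) := Real.sqrt_pos.2 (by linarith)
  rw [coe_coe_tubeLongitudePt b hr, coe_coe_slideInner_coreTubePt, sin_slideAngle_one h0.le h1,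
    cos_slideAngle_one h0.le h1]
  ext i
  rw [handleInversion_apply, hl, hA]
  fin_cases i <;> simp [tubeLongitudeVec] <;> field_simp


/-! ### §5 The slid belt maps of a multi-attachment -/

section SlideMap

open Literature.Geometry.Symplectic Bundle

universe u v

variable {ι : Type*} [Finite ι] {M : Type u} [TopologicalSpace M] [T2Space M]
  [ChartedSpace (EuclideanHalfSpace 4) M] {h : ι → HandleAttachingMap 3 2 M}
  {P : Type v} [TopologicalSpace P] [ChartedSpace (EuclideanHalfSpace 4) P]

/-- **The slid belt map `D.jB i ∘ G_{r,t} : T → P` of the `i`-th handle**: the belt tube slid by the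
isoclinic rotation `R_{φ_r(t)}` inside the handle `D⁴ ∖ S` — an attaching map of a 2-handle on `P`
for every `t` (at `t ≤ 0` the shrunken belt map, at `t ≥ 1` a tube around the `r`-longitude of the
belt circle). [cite: Kosinski1993, VI §6] -/
def slideMap (D : MultiAttachmentData h (𝓡∂ 4) P) (i : ι) (b : Bool) (r t : ℝ) : HandleAttachingMap 3 2 P where
  toFun := D.jB i ∘ slideInner b r t
  isSmoothEmbedding := IsSmoothEmbedding.comp_of_isOpen_range (D.hjB i).1
    (isSmoothEmbedding_slideInner b r t) (isOpen_range_slideInner b r t)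
  isOpen_range := by
    rw [range_comp]
    exact D.isOpenMap_jB i _ (isOpen_range_slideInner b r t)
  isBoundaryPoint y hy :=
    BeltPageClause.jB_mem_boundary_of_norm_eq_one D i _ ((norm_slideInner_eq_one_iff b r t y).2 hy)

variable (D : MultiAttachmentData h (𝓡∂ 4) P) (i : ι) (b : Bool) (r : ℝ)

/-- The slid belt map on points. [folklore] -/
@[simp] theorem slideMap_apply (t : ℝ) (y : ↥(handleTube 3 2)) :
    (slideMap D i b r t).toFun y = D.jB i (slideInner b r t y) := rfl

/-- **The attaching circle of the slid belt map is the slid belt circle.** [folklore] -/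
theorem attachingCircle_slideMap (t : ℝ) (θ : sphere (0 : EuclideanSpace ℝ (Fin 2)) 1) :
    (slideMap D i b r t).attachingCircle θ = D.jB i (slideInner b r t (coreTubePt θ)) := rfl

/-- Before the slide the attaching circle is the belt circle. [folklore] -/
theorem attachingCircle_slideMap_of_nonpos {t : ℝ} (ht : t ≤ 0) :
    (slideMap D i b r t).attachingCircle = (beltMap D i).attachingCircle := by
  funext θ
  rw [attachingCircle_slideMap, slideInner_coreTubePt_of_nonpos b r ht, attachingCircle_beltMap]

/-- The range of the slid belt map lies in the `i`-th handle. [folklore] -/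
theorem range_slideMap_subset (t : ℝ) : range (slideMap D i b r t).toFun ⊆ range (D.jB i) := by
  rintro _ ⟨y, rfl⟩; exact ⟨slideInner b r t y, rfl⟩

/-- **The slid belt maps are jointly smooth in `(t, y)`.** [folklore] -/
theorem contMDiff_slideMap_uncurry :
    ContMDiff (𝓘(ℝ, ℝ).prod (𝓡∂ 4)) (𝓡∂ 4) ∞
      fun p : ℝ × ↥(handleTube 3 2) => (slideMap D i b r p.1).toFun p.2 :=
  (D.hjB i).1.contMDiff.comp (contMDiff_slideInner_uncurry b r)

/-- Before the slide the slid belt map agrees with the belt map near the attaching sphere.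
[folklore] -/
theorem slideMap_eventuallyEq_beltMap {t : ℝ} (ht : t ≤ 0) (θ : sphere (0 : EuclideanSpace ℝ (Fin 2)) 1) :
    (slideMap D i b r t).toFun =ᶠ[𝓝 (coreTubePt θ)] (beltMap D i).toFun := by
  have ho : IsOpen {y : ↥(handleTube 3 2) |
      7 / 8 < lamSq 2 ((y : closedBall (0 : EuclideanSpace ℝ (Fin 4)) 1) : EuclideanSpace ℝ (Fin 4))} :=
    isOpen_lt continuous_const ((continuous_lamSq 2).comp
      (continuous_subtype_val.comp continuous_subtype_val))
  filter_upwards [ho.mem_nhds (lt_lamSq_coreTubePt θ)] with y hy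
  rw [slideMap_apply, slideInner_of_nonpos b r ht, tubeRho_eq_self hy, beltMap_apply]

/-- **Before the slide the handle framing is the belt framing.** [folklore] -/
theorem attachingFraming_slideMap_of_nonpos {t : ℝ} (ht : t ≤ 0) :
    (slideMap D i b r t).attachingFraming = (beltMap D i).attachingFraming := by
  funext θ
  rw [attachingFraming_eq, attachingFraming_eq]
  exact congrArg (fun L : TangentSpace (𝓡∂ 4) (coreTubePt θ) →L[ℝ] TangentSpace (𝓡∂ 4) ((beltMap D i).toFun (coreTubePt θ)) =>
    L (tubeFramingField (coreTubePt θ))) ((slideMap_eventuallyEq_beltMap D i b r ht θ).mfderiv_eq)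

variable [IsManifold (𝓡∂ 4) ∞ P] [T2Space P]

/-- **The slide of the belt circle as an isotopy of knots in `∂P`** (stages: the attaching circles
of the slid belt maps). [cite: Kosinski1993, VI §6] -/
def slideIsotopy : KnotIsotopyInBoundary (beltMap D i).attachingCircle (slideMap D i b r 1).attachingCircle where
  toFun t := (slideMap D i b r t).attachingCircle
  contMDiff := by
    have hc := (contMDiff_slideMap_uncurry D i b r).comp
      ((contMDiff_fst (I := 𝓘(ℝ, ℝ)) (J := 𝓡 1) (M := ℝ) (N := sphere (0 : EuclideanSpace ℝ (Fin 2)) 1)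
        (n := ∞)).prodMk (contMDiff_coreTubePt.comp contMDiff_snd))
    exact hc.congr fun p => rfl
  isSmoothEmbedding t := isSmoothEmbedding_attachingCircle (slideMap D i b r t)
  map_zero := attachingCircle_slideMap_of_nonpos D i b r le_rfl
  map_one := rfl
  isBoundaryPoint t _ θ := (slideMap D i b r t).isBoundaryPoint_attachingCircle θ

/-- Stages of the slide isotopy. [folklore] -/
@[simp] theorem slideIsotopy_toFun (t : ℝ) : (slideIsotopy D i b r).toFun t = (slideMap D i b r t).attachingCircle :=
  rfl

/-- **The belt framing is carried along the slide by the handle framings of the slid belt maps**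
(joint continuity: the tangent map of the jointly smooth `(t, y) ↦ D.jB i (G_{r,t} y)` applied to
the continuous section `(t, θ) ↦ ((t, (θ, 0)), (0, e₂))`). [folklore] -/
theorem isFramingAlong_slide :
    IsFramingAlong (slideIsotopy D i b r) (beltMap D i).attachingFraming
      fun t => (slideMap D i b r t).attachingFraming where
  apply_zero := attachingFraming_slideMap_of_nonpos D i b r le_rfl
  isKnotFraming t _ := isKnotFraming_attachingFraming (slideMap D i b r t)
  continuousOn := by
    set F : ℝ × ↥(handleTube 3 2) → P := fun p => (slideMap D i b r p.1).toFun p.2 with hF_def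
    have hFs : ContMDiff (𝓘(ℝ, ℝ).prod (𝓡∂ 4)) (𝓡∂ 4) ∞ F := contMDiff_slideMap_uncurry D i b r
    have hFc : Continuous (tangentMap (𝓘(ℝ, ℝ).prod (𝓡∂ 4)) (𝓡∂ 4) F) := hFs.continuous_tangentMap (by simp)
    set σ : ℝ × (sphere (0 : EuclideanSpace ℝ (Fin 2)) 1) →
        TangentBundle (𝓘(ℝ, ℝ).prod (𝓡∂ 4)) (ℝ × ↥(handleTube 3 2)) := fun p =>
      (equivTangentBundleProd 𝓘(ℝ, ℝ) ℝ (𝓡∂ 4) ↥(handleTube 3 2)).symm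
        (zeroSection ℝ (TangentSpace 𝓘(ℝ, ℝ) : ℝ → Type) p.1,
          (TotalSpace.mk' (EuclideanSpace ℝ (Fin 4)) (coreTubePt p.2) (tubeFramingField (coreTubePt p.2)) :
            TangentBundle (𝓡∂ 4) ↥(handleTube 3 2))) with hσ_def
    have hσc : Continuous σ := by
      have he : Continuous (equivTangentBundleProd 𝓘(ℝ, ℝ) ℝ (𝓡∂ 4) ↥(handleTube 3 2)).symm :=
        (contMDiff_equivTangentBundleProd_symm (n := ∞)).continuous
      refine he.comp (Continuous.prodMk ?_ (continuous_coreSection.comp continuous_snd))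
      exact (Bundle.Trivialization.continuous_zeroSection ℝ (F := ℝ)
        (E := (TangentSpace 𝓘(ℝ, ℝ) : ℝ → Type))).comp continuous_fst
    refine ((hFc.comp hσc).congr fun p => ?_).continuousOn
    show tangentMap (𝓘(ℝ, ℝ).prod (𝓡∂ 4)) (𝓡∂ 4) F (σ p) =
      (TotalSpace.mk' (EuclideanSpace ℝ (Fin 4)) ((slideMap D i b r p.1).attachingCircle p.2)
        ((slideMap D i b r p.1).attachingFraming p.2) : TangentBundle (𝓡∂ 4) P)
    have hσp : σ p = ⟨(p.1, coreTubePt p.2), ((0 : ℝ), tubeFramingField (coreTubePt p.2))⟩ := rfl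
    rw [hσp, tangentMap]
    have hd : MDifferentiableAt (𝓘(ℝ, ℝ).prod (𝓡∂ 4)) (𝓡∂ 4) F (p.1, coreTubePt p.2) :=
      (hFs _).mdifferentiableAt (by simp)
    have hv : mfderiv (𝓘(ℝ, ℝ).prod (𝓡∂ 4)) (𝓡∂ 4) F (p.1, coreTubePt p.2)
        ((0 : ℝ), tubeFramingField (coreTubePt p.2)) = (slideMap D i b r p.1).attachingFraming p.2 := by
      rw [mfderiv_prod_eq_add_apply hd]
      have h0 : (mfderiv 𝓘(ℝ, ℝ) (𝓡∂ 4) (fun z : ℝ => F (z, coreTubePt p.2)) p.1) (0 : ℝ) = 0 := map_zero _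
      rw [h0, zero_add, attachingFraming_eq]
    rw [hv]
    rfl

/-- **The slides of the belt circles of all handles form an isotopy of LINKS in `∂P`** (each
component stays in its own handle). [cite: Kosinski1993, VI §6] -/
def slideLinkIsotopy (b : ι → Bool) (r : ι → ℝ) :
    LinkIsotopyInBoundary (fun i => (beltMap D i).attachingCircle)
      (fun i => (slideMap D i (b i) (r i) 1).attachingCircle) where
  isotopy i := slideIsotopy D i (b i) (r i)
  disjoint t _ i j hij := by
    refine (D.disjointB hij).mono ?_ ?_
    · rintro _ ⟨θ, rfl⟩; exact ⟨_, rfl⟩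
    · rintro _ ⟨θ, rfl⟩; exact ⟨_, rfl⟩

omit [IsManifold (𝓡∂ 4) ∞ P] [T2Space P] in
/-- **The end of the slide is glued to the `r`-longitude of the attaching circle**: for
`0 < r ≤ 1/2`, the slid belt circle `D.jB i (G_{r,1} (θ, 0))` is the point
`D.jA (h̄ᵢ (√(1-r²) θ, ±, r θ))` of the base piece (Kosinski's identification `x ∼ h̄ α(x)`).
[cite: Kosinski1993, VI §6] -/
theorem attachingCircle_slideMap_one {r : ℝ} (h0 : 0 < r) (h1 : r ≤ 1 / 2)
    (θ : sphere (0 : EuclideanSpace ℝ (Fin 2)) 1) :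
    (slideMap D i b r 1).attachingCircle θ =
      D.jA ⟨(h i).toFun (tubeLongitudePt b r θ), BeltPageClause.apply_mem_coresComplement_of_lamSq_ne_one
        D.disjoint i _ (lamSq_tubeLongitudePt_ne_one b h0.ne' (by nlinarith) θ)⟩ := by
  rw [BeltPageClause.jA_apply_eq_jB D i _ (lamSq_tubeLongitudePt_ne_one b h0.ne' (by nlinarith) θ),
    attachingCircle_slideMap]
  congr 1
  apply Subtype.ext; apply Subtype.ext
  exact (handleInversion_tubeLongitudePt b h0 h1 θ).symm


end SlideMap


/-! ### §6 Registered helper -/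

/-- **Registered helper `helper_belt_slideLongitude` (stages 1–2 of node T3c-1 of NF6
`stub_steinRealisation`, wave 2, lead c5): in `∂P`, the framed belt circles of a multi-attachment
are link-isotopic, each inside its own handle, to the `D.jA ∘ h̄ᵢ`-images of the `r`-longitudes
`(√(1-r²) θ₀, ∓√(1-r²) θ₁, r θ₀, r θ₁)` of the attaching circles, the belt framings being carried by
the handle framings of the slid belt maps** (per handle a direction `b i` and a radius
`0 < r i ≤ 1/2`). [cite: Kosinski1993, VI §6] -/
theorem helper_belt_slideLongitude :
    ∀ {ι : Type} [Finite ι] {M : Type} [TopologicalSpace M] [T2Space M]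
      [ChartedSpace (EuclideanHalfSpace 4) M]
      {h : ι → Literature.Topology.FourManifolds.HandleAttachingMap 3 2 M}
      {P : Type} [TopologicalSpace P] [T2Space P] [ChartedSpace (EuclideanHalfSpace 4) P]
      [IsManifold (𝓡∂ 4) ∞ P]
      (D : Literature.Topology.FourManifolds.HandleAttachingMap.MultiAttachmentData h (𝓡∂ 4) P)
      (b : ι → Bool) (r : ι → ℝ), (∀ i, 0 < r i) → (∀ i, r i ≤ 1 / 2) →
      ∃ (q : ι → ℝ → Literature.Topology.FourManifolds.HandleAttachingMap 3 2 P)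
        (y : ι → Metric.sphere (0 : EuclideanSpace ℝ (Fin 2)) 1 →
          ↥(Literature.Topology.FourManifolds.handleTube 3 2))
        (hy : ∀ i θ, (h i).toFun (y i θ) ∈
          Literature.Topology.FourManifolds.HandleAttachingMap.coresComplement h)
        (Φ : Literature.Geometry.Symplectic.LinkIsotopyInBoundary
          (fun i => (Summit.SmoothPoincare4.SmoothPoincare4.Theorems.AcyclicBisectionExists.ModpBraidOrbits.beltMap
            D i).attachingCircle)
          (fun i θ => D.jA ⟨(h i).toFun (y i θ), hy i θ⟩)),
        (∀ i t, (Φ.isotopy i).toFun t = (q i t).attachingCircle) ∧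
        (∀ i, Literature.Geometry.Symplectic.IsFramingAlong (Φ.isotopy i)
          (Summit.SmoothPoincare4.SmoothPoincare4.Theorems.AcyclicBisectionExists.ModpBraidOrbits.beltMap
            D i).attachingFraming fun t => (q i t).attachingFraming) ∧
        (∀ i t, Set.range (q i t).toFun ⊆ Set.range (D.jB i)) ∧
        (∀ i θ, (((y i θ : ↥(Literature.Topology.FourManifolds.handleTube 3 2)) :
            Metric.closedBall (0 : EuclideanSpace ℝ (Fin 4)) 1) : EuclideanSpace ℝ (Fin 4)) =
          WithLp.toLp 2 ![Real.sqrt (1 - r i ^ 2) * (θ : EuclideanSpace ℝ (Fin 2)) 0,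
            (if b i then -1 else 1) * Real.sqrt (1 - r i ^ 2) * (θ : EuclideanSpace ℝ (Fin 2)) 1,
            r i * (θ : EuclideanSpace ℝ (Fin 2)) 0, r i * (θ : EuclideanSpace ℝ (Fin 2)) 1]) := by
  intro ι _ M _ _ _ h P _ _ _ _ D b r hr0 hr1
  have hsq : ∀ i, r i ^ 2 < 1 := fun i => by nlinarith [hr0 i, hr1 i]
  have key : ∀ (L' : ι → sphere (0 : EuclideanSpace ℝ (Fin 2)) 1 → P)
      (_ : (fun i => (slideMap D i (b i) (r i) 1).attachingCircle) = L'),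
      ∃ Φ : Literature.Geometry.Symplectic.LinkIsotopyInBoundary (fun i => (beltMap D i).attachingCircle) L',
        (∀ i t, (Φ.isotopy i).toFun t = (slideMap D i (b i) (r i) t).attachingCircle) ∧
        ∀ i, Literature.Geometry.Symplectic.IsFramingAlong (Φ.isotopy i) (beltMap D i).attachingFraming
          fun t => (slideMap D i (b i) (r i) t).attachingFraming := by
    intro L' e
    subst e
    exact ⟨slideLinkIsotopy D b r, fun i t => rfl, fun i => isFramingAlong_slide D i (b i) (r i)⟩
  obtain ⟨Φ, hΦ, hfr⟩ := key (fun i θ => D.jA ⟨(h i).toFun (tubeLongitudePt (b i) (r i) θ),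
    BeltPageClause.apply_mem_coresComplement_of_lamSq_ne_one D.disjoint i _
      (lamSq_tubeLongitudePt_ne_one (b i) (hr0 i).ne' (hsq i) θ)⟩)
    (funext fun i => funext fun θ => attachingCircle_slideMap_one D i (b i) (hr0 i) (hr1 i) θ)
  refine ⟨fun i t => slideMap D i (b i) (r i) t, fun i θ => tubeLongitudePt (b i) (r i) θ, _, Φ, hΦ, hfr,
    fun i t => range_slideMap_subset D i (b i) (r i) t, fun i θ => ?_⟩
  rw [coe_coe_tubeLongitudePt (b i) (hsq i)]; rfl

end Summit.SmoothPoincare4.SmoothPoincare4.Theorems.AcyclicBisectionExists.ModpBraidOrbits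

end
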